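import Summits.Ventures.Crystal3D.Theorems.StickyWulffConstantCoaxialWallLawKissingCage
import HarnessLib

/-!
# The LOCAL kissing cage and the divacancy law: a foreign contact needs an ADJACENT vacant pair at its host
# (crux `CoaxialWallLaw`, stmt-Ventures-19481, line `WallLedgerF`; census-free brick for the OFF-MODULE tail)

HONEST FRAMING. Venture `Summits/Ventures/Crystal3D` (cell `crystal3d-full`), helper `--supports` the crux
`CoaxialWallLaw` (stmt-Ventures-19481, `route-Ventures-StickyWulffConstant`), REGISTERED line `WallLedgerF` (planner
cf-p1, (lvi)/(lxii): bricks for the off-module tail).  Rung credit; F-C1 not moved; census-free.  Sharpens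
`…CoaxialWallLawKissingCage` (`eq_slot_of_kissing_cage` needed ELEVEN readings; here FOUR suffice).

* `local_cage_one`, `local_cage_core_triple` — cubic-coordinate cells: `Σ xᵢ² = 2`, `x·s ≥ 1` and `x·n ≤ 1` for the
  four slots `n` adjacent to `s` (`n·s = 1`) force `x = s`;
* `slot_cover_core`, **`exists_slot_inner_ge_half`** — the closed `60°`-caps of a slot dozen COVER the sphere:
  every unit `t` has `⟪t, G v⟫ ≥ ½` for some slot `v`;
* **`eq_slot_of_local_cage`** — unit `t` with `⟪t, G v⟫ ≥ ½` and `⟪t, G w⟫ ≤ ½` for the four slots `w` adjacent to `v`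
  IS `G v`;
* **`foreign_contact_adjacent_divacancy`** — `X` `1`-separated, `x ∈ X` touching `y` off the frame `y + G·slots`: there are
  two ADJACENT slots `v, n` (`⟪v, n⟫ = ½`), BOTH vacant at `y` and both strictly blocked by `x` (`⟪x − y, G v⟫ > ½`,
  `⟪x − y, G n⟫ > ½`, so neither site can ever be filled);
* `contact_on_frame_of_no_adjacent_divacancy` — hence a host none of whose adjacent slot pairs is doubly vacant (e.g.
  isolated vacancies, the `√7` vacancy triangle, the c1 pair) is touched only on its frame.
WHAT THIS IS NOT: not the tail; F-C1 not moved.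
-/

noncomputable section

namespace Summit.Ventures.Crystal3D.Theorems

open Summit.Ventures.Crystal3D Finset NearIdentity
open scoped InnerProductSpace

/-! ### Cells -/

/-- **Local cage, canonical cell** (target `(1, 1, 0)`, cap `u + w ≥ 1`, the four neighbours `(1,0,±1), (0,1,±1)`). -/
theorem local_cage_one (u w z : ℝ) (hn : u ^ 2 + w ^ 2 + z ^ 2 = 2) (hcap : 1 ≤ u + w)
    (h4 : u + z ≤ 1) (h5 : u - z ≤ 1) (h8 : w + z ≤ 1) (h9 : w - z ≤ 1) :
    u = 1 ∧ w = 1 ∧ z = 0 := by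
  have hz : z = 0 := by
    nlinarith [mul_nonneg (sub_nonneg.2 h4) (sub_nonneg.2 h9), mul_nonneg (sub_nonneg.2 h5) (sub_nonneg.2 h8),
      mul_nonneg (sub_nonneg.2 h4) (sub_nonneg.2 h8), mul_nonneg (sub_nonneg.2 h5) (sub_nonneg.2 h9), sq_nonneg z,
      sq_nonneg (u - w)]
  subst hz
  have hu : u = 1 := by nlinarith
  subst hu
  have hw : w = 1 := by nlinarith
  exact ⟨rfl, hw, rfl⟩

/-- **Local cage core** (integer-triple form): `Σ xᵢ² = 2`, `x·(a,b,c) ≥ 1` and `x·τ ≤ 1` for the four slot triples `τ`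
with `τ·(a,b,c) = 1` force `x = (a, b, c)`. -/
theorem local_cage_core_triple (x : Fin 3 → ℝ) (hn : x 0 ^ 2 + x 1 ^ 2 + x 2 ^ 2 = 2) (a b c : ℤ)
    (habc : (a, b, c) ∈ ({(1, 1, 0), (1, -1, 0), (-1, 1, 0), (-1, -1, 0), (1, 0, 1), (1, 0, -1), (-1, 0, 1), (-1, 0, -1), (0, 1, 1), (0, 1, -1), (0, -1, 1), (0, -1, -1)} : Finset (ℤ × ℤ × ℤ)))
    (hcap : 1 ≤ x 0 * a + x 1 * b + x 2 * c)
    (h : ∀ τ ∈ ({(1, 1, 0), (1, -1, 0), (-1, 1, 0), (-1, -1, 0), (1, 0, 1), (1, 0, -1), (-1, 0, 1), (-1, 0, -1), (0, 1, 1), (0, 1, -1), (0, -1, 1), (0, -1, -1)} : Finset (ℤ × ℤ × ℤ)), a * τ.1 + b * τ.2.1 + c * τ.2.2 = 1 →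
      x 0 * τ.1 + x 1 * τ.2.1 + x 2 * τ.2.2 ≤ 1) :
    x 0 = a ∧ x 1 = b ∧ x 2 = c := by
  simp only [Finset.mem_insert, Finset.mem_singleton, Prod.mk.injEq] at habc
  rcases habc with ⟨rfl, rfl, rfl⟩ | ⟨rfl, rfl, rfl⟩ | ⟨rfl, rfl, rfl⟩ | ⟨rfl, rfl, rfl⟩ | ⟨rfl, rfl, rfl⟩ | ⟨rfl, rfl, rfl⟩ | ⟨rfl, rfl, rfl⟩ | ⟨rfl, rfl, rfl⟩ | ⟨rfl, rfl, rfl⟩ | ⟨rfl, rfl, rfl⟩ | ⟨rfl, rfl, rfl⟩ | ⟨rfl, rfl, rfl⟩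
  · -- slot (1, 1, 0)
    have g0 := h (1, 0, 1) (by decide) (by norm_num)
    have g1 := h (1, 0, -1) (by decide) (by norm_num)
    have g2 := h (0, 1, 1) (by decide) (by norm_num)
    have g3 := h (0, 1, -1) (by decide) (by norm_num)
    norm_num at g0 g1 g2 g3 hcap
    obtain ⟨e1, e2, e3⟩ := local_cage_one (x 0) (x 1) (x 2) (by nlinarith [hn]) (by linarith [hcap]) (by linarith [g0]) (by linarith [g1]) (by linarith [g2]) (by linarith [g3])
    push_cast
    exact ⟨by linarith, by linarith, by linarith⟩
  · -- slot (1, -1, 0)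
    have g0 := h (1, 0, 1) (by decide) (by norm_num)
    have g1 := h (1, 0, -1) (by decide) (by norm_num)
    have g2 := h (0, -1, 1) (by decide) (by norm_num)
    have g3 := h (0, -1, -1) (by decide) (by norm_num)
    norm_num at g0 g1 g2 g3 hcap
    obtain ⟨e1, e2, e3⟩ := local_cage_one (x 0) (-x 1) (x 2) (by nlinarith [hn]) (by linarith [hcap]) (by linarith [g0]) (by linarith [g1]) (by linarith [g2]) (by linarith [g3])
    push_cast
    exact ⟨by linarith, by linarith, by linarith⟩
  · -- slot (-1, 1, 0)
    have g0 := h (-1, 0, 1) (by decide) (by norm_num)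
    have g1 := h (-1, 0, -1) (by decide) (by norm_num)
    have g2 := h (0, 1, 1) (by decide) (by norm_num)
    have g3 := h (0, 1, -1) (by decide) (by norm_num)
    norm_num at g0 g1 g2 g3 hcap
    obtain ⟨e1, e2, e3⟩ := local_cage_one (-x 0) (x 1) (x 2) (by nlinarith [hn]) (by linarith [hcap]) (by linarith [g0]) (by linarith [g1]) (by linarith [g2]) (by linarith [g3])
    push_cast
    exact ⟨by linarith, by linarith, by linarith⟩
  · -- slot (-1, -1, 0)
    have g0 := h (-1, 0, 1) (by decide) (by norm_num)
    have g1 := h (-1, 0, -1) (by decide) (by norm_num)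
    have g2 := h (0, -1, 1) (by decide) (by norm_num)
    have g3 := h (0, -1, -1) (by decide) (by norm_num)
    norm_num at g0 g1 g2 g3 hcap
    obtain ⟨e1, e2, e3⟩ := local_cage_one (-x 0) (-x 1) (x 2) (by nlinarith [hn]) (by linarith [hcap]) (by linarith [g0]) (by linarith [g1]) (by linarith [g2]) (by linarith [g3])
    push_cast
    exact ⟨by linarith, by linarith, by linarith⟩
  · -- slot (1, 0, 1)
    have g0 := h (1, 1, 0) (by decide) (by norm_num)
    have g1 := h (1, -1, 0) (by decide) (by norm_num)
    have g2 := h (0, 1, 1) (by decide) (by norm_num)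
    have g3 := h (0, -1, 1) (by decide) (by norm_num)
    norm_num at g0 g1 g2 g3 hcap
    obtain ⟨e1, e2, e3⟩ := local_cage_one (x 0) (x 2) (x 1) (by nlinarith [hn]) (by linarith [hcap]) (by linarith [g0]) (by linarith [g1]) (by linarith [g2]) (by linarith [g3])
    push_cast
    exact ⟨by linarith, by linarith, by linarith⟩
  · -- slot (1, 0, -1)
    have g0 := h (1, 1, 0) (by decide) (by norm_num)
    have g1 := h (1, -1, 0) (by decide) (by norm_num)
    have g2 := h (0, 1, -1) (by decide) (by norm_num)
    have g3 := h (0, -1, -1) (by decide) (by norm_num)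
    norm_num at g0 g1 g2 g3 hcap
    obtain ⟨e1, e2, e3⟩ := local_cage_one (x 0) (-x 2) (x 1) (by nlinarith [hn]) (by linarith [hcap]) (by linarith [g0]) (by linarith [g1]) (by linarith [g2]) (by linarith [g3])
    push_cast
    exact ⟨by linarith, by linarith, by linarith⟩
  · -- slot (-1, 0, 1)
    have g0 := h (-1, 1, 0) (by decide) (by norm_num)
    have g1 := h (-1, -1, 0) (by decide) (by norm_num)
    have g2 := h (0, 1, 1) (by decide) (by norm_num)
    have g3 := h (0, -1, 1) (by decide) (by norm_num)
    norm_num at g0 g1 g2 g3 hcap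
    obtain ⟨e1, e2, e3⟩ := local_cage_one (-x 0) (x 2) (x 1) (by nlinarith [hn]) (by linarith [hcap]) (by linarith [g0]) (by linarith [g1]) (by linarith [g2]) (by linarith [g3])
    push_cast
    exact ⟨by linarith, by linarith, by linarith⟩
  · -- slot (-1, 0, -1)
    have g0 := h (-1, 1, 0) (by decide) (by norm_num)
    have g1 := h (-1, -1, 0) (by decide) (by norm_num)
    have g2 := h (0, 1, -1) (by decide) (by norm_num)
    have g3 := h (0, -1, -1) (by decide) (by norm_num)
    norm_num at g0 g1 g2 g3 hcap
    obtain ⟨e1, e2, e3⟩ := local_cage_one (-x 0) (-x 2) (x 1) (by nlinarith [hn]) (by linarith [hcap]) (by linarith [g0]) (by linarith [g1]) (by linarith [g2]) (by linarith [g3])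
    push_cast
    exact ⟨by linarith, by linarith, by linarith⟩
  · -- slot (0, 1, 1)
    have g0 := h (1, 1, 0) (by decide) (by norm_num)
    have g1 := h (-1, 1, 0) (by decide) (by norm_num)
    have g2 := h (1, 0, 1) (by decide) (by norm_num)
    have g3 := h (-1, 0, 1) (by decide) (by norm_num)
    norm_num at g0 g1 g2 g3 hcap
    obtain ⟨e1, e2, e3⟩ := local_cage_one (x 1) (x 2) (x 0) (by nlinarith [hn]) (by linarith [hcap]) (by linarith [g0]) (by linarith [g1]) (by linarith [g2]) (by linarith [g3])
    push_cast
    exact ⟨by linarith, by linarith, by linarith⟩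
  · -- slot (0, 1, -1)
    have g0 := h (1, 1, 0) (by decide) (by norm_num)
    have g1 := h (-1, 1, 0) (by decide) (by norm_num)
    have g2 := h (1, 0, -1) (by decide) (by norm_num)
    have g3 := h (-1, 0, -1) (by decide) (by norm_num)
    norm_num at g0 g1 g2 g3 hcap
    obtain ⟨e1, e2, e3⟩ := local_cage_one (x 1) (-x 2) (x 0) (by nlinarith [hn]) (by linarith [hcap]) (by linarith [g0]) (by linarith [g1]) (by linarith [g2]) (by linarith [g3])
    push_cast
    exact ⟨by linarith, by linarith, by linarith⟩
  · -- slot (0, -1, 1)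
    have g0 := h (1, -1, 0) (by decide) (by norm_num)
    have g1 := h (-1, -1, 0) (by decide) (by norm_num)
    have g2 := h (1, 0, 1) (by decide) (by norm_num)
    have g3 := h (-1, 0, 1) (by decide) (by norm_num)
    norm_num at g0 g1 g2 g3 hcap
    obtain ⟨e1, e2, e3⟩ := local_cage_one (-x 1) (x 2) (x 0) (by nlinarith [hn]) (by linarith [hcap]) (by linarith [g0]) (by linarith [g1]) (by linarith [g2]) (by linarith [g3])
    push_cast
    exact ⟨by linarith, by linarith, by linarith⟩
  · -- slot (0, -1, -1)
    have g0 := h (1, -1, 0) (by decide) (by norm_num)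
    have g1 := h (-1, -1, 0) (by decide) (by norm_num)
    have g2 := h (1, 0, -1) (by decide) (by norm_num)
    have g3 := h (-1, 0, -1) (by decide) (by norm_num)
    norm_num at g0 g1 g2 g3 hcap
    obtain ⟨e1, e2, e3⟩ := local_cage_one (-x 1) (-x 2) (x 0) (by nlinarith [hn]) (by linarith [hcap]) (by linarith [g0]) (by linarith [g1]) (by linarith [g2]) (by linarith [g3])
    push_cast
    exact ⟨by linarith, by linarith, by linarith⟩

/-- **Covering cell**: no `x` with `Σ xᵢ² = 2` has `x·s < 1` for the eight slots through the `0`-axis (already the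
four antipodal products over the pairs `(0,1)`, `(0,2)` sum to `4 − 4x₀² − 2x₁² − 2x₂² = −2x₀²`). -/
theorem slot_cover_core (x : Fin 3 → ℝ) (hn : x 0 ^ 2 + x 1 ^ 2 + x 2 ^ 2 = 2)
    (h0 : x 0 + x 1 < 1) (h1 : x 0 - x 1 < 1) (h2 : -x 0 + x 1 < 1) (h3 : -x 0 - x 1 < 1)
    (h4 : x 0 + x 2 < 1) (h5 : x 0 - x 2 < 1) (h6 : -x 0 + x 2 < 1) (h7 : -x 0 - x 2 < 1) : False := by
  nlinarith [mul_pos (sub_pos.2 h0) (sub_pos.2 h3), mul_pos (sub_pos.2 h1) (sub_pos.2 h2),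
    mul_pos (sub_pos.2 h4) (sub_pos.2 h7), mul_pos (sub_pos.2 h5) (sub_pos.2 h6), sq_nonneg (x 0)]

/-- Every table triple is the triple of a slot label. -/
theorem exists_slotInt_of_triple_mem :
    ∀ τ ∈ ({(1, 1, 0), (1, -1, 0), (-1, 1, 0), (-1, -1, 0), (1, 0, 1), (1, 0, -1), (-1, 0, 1), (-1, 0, -1), (0, 1, 1), (0, 1, -1), (0, -1, 1), (0, -1, -1)} : Finset (ℤ × ℤ × ℤ)), ∃ l : Fin 12, (slotInt l 0, slotInt l 1, slotInt l 2) = τ := by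
  decide

/-! ### Geometry -/

/-- **The slot caps cover the sphere**: every unit vector is within `60°` of some reading of any frame. -/
theorem exists_slot_inner_ge_half (G : EuclideanSpace ℝ (Fin 3) ≃ₗᵢ[ℝ] EuclideanSpace ℝ (Fin 3))
    {t : EuclideanSpace ℝ (Fin 3)} (ht : ‖t‖ = 1) : ∃ v ∈ fccSlots, 1 / 2 ≤ ⟪t, G v⟫_ℝ := by
  by_contra hcon
  push Not at hcon
  set s := G.symm t with hs
  have hts : t = G s := by simp [hs]
  have hsn : ‖s‖ = 1 := by rw [hs, LinearIsometryEquiv.norm_map, ht]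
  have h2 : Real.sqrt 2 ^ 2 = 2 := Real.sq_sqrt (by norm_num)
  have h2pos : 0 < Real.sqrt 2 := Real.sqrt_pos.2 (by norm_num)
  set x : Fin 3 → ℝ := fun i => Real.sqrt 2 * cubicCoords s i with hx
  have hn : x 0 ^ 2 + x 1 ^ 2 + x 2 ^ 2 = 2 := by
    have := norm_sq_eq_cubicCoords_sum s
    rw [hsn] at this
    simp only [hx, mul_pow, h2]; nlinarith [this]
  have hlt : ∀ l : Fin 12, x 0 * slotInt l 0 + x 1 * slotInt l 1 + x 2 * slotInt l 2 < 1 := by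
    intro l
    have h1 := hcon (slotSite l) (slotSite_mem l)
    rw [hts, LinearIsometryEquiv.inner_map_map, inner_slotSite_right, div_lt_iff₀ h2pos] at h1
    simp only [hx]
    nlinarith [h1, h2]
  have g0 := hlt 0
  have g1 := hlt 1
  have g2 := hlt 2
  have g3 := hlt 3
  have g4 := hlt 4
  have g5 := hlt 5
  have g6 := hlt 6
  have g7 := hlt 7
  simp only [slotInt, Matrix.cons_val_zero, Matrix.cons_val_one, Matrix.cons_val] at g0 g1 g2 g3 g4 g5 g6 g7
  norm_num at g0 g1 g2 g3 g4 g5 g6 g7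
  exact slot_cover_core x hn (by linarith) (by linarith) (by linarith) (by linarith) (by linarith) (by linarith)
    (by linarith) (by linarith)

/-- **THE LOCAL KISSING CAGE.**  For any frame `G`, slot `v` and unit `t`: if `⟪t, G v⟫ ≥ ½` (`t` in the closed
`60°`-cap of the reading `G v`) and `⟪t, G w⟫ ≤ ½` for the FOUR slots `w` adjacent to `v` (`⟪w, v⟫ = ½`), then
`t = G v`. -/
theorem eq_slot_of_local_cage (G : EuclideanSpace ℝ (Fin 3) ≃ₗᵢ[ℝ] EuclideanSpace ℝ (Fin 3))
    {v : EuclideanSpace ℝ (Fin 3)} (hv : v ∈ fccSlots) {t : EuclideanSpace ℝ (Fin 3)} (ht : ‖t‖ = 1)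
    (hcap : 1 / 2 ≤ ⟪t, G v⟫_ℝ) (h : ∀ w ∈ fccSlots, ⟪w, v⟫_ℝ = 1 / 2 → ⟪t, G w⟫_ℝ ≤ 1 / 2) : t = G v := by
  obtain ⟨k, rfl⟩ := exists_slotSite_eq hv
  set s := G.symm t with hs
  have hts : t = G s := by simp [hs]
  have hsn : ‖s‖ = 1 := by rw [hs, LinearIsometryEquiv.norm_map, ht]
  have h2 : Real.sqrt 2 ^ 2 = 2 := Real.sq_sqrt (by norm_num)
  have h2pos : 0 < Real.sqrt 2 := Real.sqrt_pos.2 (by norm_num)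
  set x : Fin 3 → ℝ := fun i => Real.sqrt 2 * cubicCoords s i with hx
  have hn : x 0 ^ 2 + x 1 ^ 2 + x 2 ^ 2 = 2 := by
    have := norm_sq_eq_cubicCoords_sum s
    rw [hsn] at this
    simp only [hx, mul_pow, h2]; nlinarith [this]
  -- the cap condition in coordinates
  have hcap' : 1 ≤ x 0 * (slotInt k 0 : ℝ) + x 1 * slotInt k 1 + x 2 * slotInt k 2 := by
    rw [hts, LinearIsometryEquiv.inner_map_map, inner_slotSite_right, le_div_iff₀ h2pos] at hcap
    simp only [hx]
    nlinarith [hcap, h2]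
  -- the four neighbour conditions in coordinates
  have hle : ∀ τ ∈ ({(1, 1, 0), (1, -1, 0), (-1, 1, 0), (-1, -1, 0), (1, 0, 1), (1, 0, -1), (-1, 0, 1), (-1, 0, -1),
      (0, 1, 1), (0, 1, -1), (0, -1, 1), (0, -1, -1)} : Finset (ℤ × ℤ × ℤ)),
      slotInt k 0 * τ.1 + slotInt k 1 * τ.2.1 + slotInt k 2 * τ.2.2 = 1 →
      x 0 * τ.1 + x 1 * τ.2.1 + x 2 * τ.2.2 ≤ 1 := by
    intro τ hτ hdot
    obtain ⟨l, rfl⟩ := exists_slotInt_of_triple_mem τ hτ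
    have hwv : ⟪slotSite l, slotSite k⟫_ℝ = 1 / 2 := by
      rw [inner_slotSite]
      have : slotInt l ⬝ᵥ slotInt k = 1 := by
        simp only [dotProduct, Fin.sum_univ_three]; simp only at hdot; linarith
      rw [this]; norm_num
    have h1 := h (slotSite l) (slotSite_mem l) hwv
    rw [hts, LinearIsometryEquiv.inner_map_map, inner_slotSite_right, div_le_iff₀ h2pos] at h1
    simp only [hx]
    nlinarith [h1, h2]
  obtain ⟨e0, e1, e2⟩ := local_cage_core_triple x hn _ _ _ (slotInt_triple_mem k) hcap' hle
  have hcs : cubicCoords s = cubicCoords (slotSite k) := by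
    rw [cubicCoords_slotSite]
    ext i
    simp only [slotVec]
    rw [eq_div_iff h2pos.ne']
    fin_cases i
    · simpa [hx, mul_comm] using e0
    · simpa [hx, mul_comm] using e1
    · simpa [hx, mul_comm] using e2
  rw [hts, cubicCoords_injective hcs]

/-! ### The divacancy law -/

/-- One step of the divacancy law: if `⟪t, G v⟫ ≥ ½` and `t ≠ G v`, some slot `n` adjacent to `v` has `⟪t, G n⟫ > ½`
(contrapositive of the local cage). -/
theorem exists_adjacent_inner_gt_half (G : EuclideanSpace ℝ (Fin 3) ≃ₗᵢ[ℝ] EuclideanSpace ℝ (Fin 3))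
    {v : EuclideanSpace ℝ (Fin 3)} (hv : v ∈ fccSlots) {t : EuclideanSpace ℝ (Fin 3)} (ht : ‖t‖ = 1)
    (hcap : 1 / 2 ≤ ⟪t, G v⟫_ℝ) (hne : t ≠ G v) :
    ∃ n ∈ fccSlots, ⟪n, v⟫_ℝ = 1 / 2 ∧ 1 / 2 < ⟪t, G n⟫_ℝ := by
  by_contra hcon
  push Not at hcon
  exact hne (eq_slot_of_local_cage G hv ht hcap fun w hw hwv => hcon w hw hwv)

/-- In a `1`-separated configuration a slot strictly blocked by a contact `x` of `y` (`⟪x − y, G n⟫ > ½`) is vacant. -/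
theorem vacant_of_blocked {X : Finset (EuclideanSpace ℝ (Fin 3))} (hX : ∀ p ∈ X, ∀ q ∈ X, p ≠ q → 1 ≤ dist p q)
    (G : EuclideanSpace ℝ (Fin 3) ≃ₗᵢ[ℝ] EuclideanSpace ℝ (Fin 3)) {y x n : EuclideanSpace ℝ (Fin 3)} (hx : x ∈ X)
    (hd : dist x y = 1) (hn : n ∈ fccSlots) (hxn : x ≠ y + G n) (hblock : 1 / 2 < ⟪x - y, G n⟫_ℝ) :
    y + G n ∉ X := by
  intro hocc
  have ht : ‖x - y‖ = 1 := by rwa [← dist_eq_norm]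
  have hGn : ‖G n‖ = 1 := by rw [LinearIsometryEquiv.norm_map, norm_eq_one_of_mem_fccSlots hn]
  have hsep := hX x hx (y + G n) hocc hxn
  rw [dist_eq_norm, show x - (y + G n) = x - y - G n by abel] at hsep
  have := inner_le_half_of_norm_sub_ge_one ht hGn hsep
  linarith

/-- **THE DIVACANCY LAW.**  In a `1`-separated configuration `X`, a ball `x ∈ X` touching `y` OFF the frame
`y + G·(slots)` requires two ADJACENT slots `v, n` (`⟪v, n⟫ = ½`) that are BOTH vacant at `y` and both strictly blocked
by `x`. -/
theorem foreign_contact_adjacent_divacancy {X : Finset (EuclideanSpace ℝ (Fin 3))}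
    (hX : ∀ p ∈ X, ∀ q ∈ X, p ≠ q → 1 ≤ dist p q)
    (G : EuclideanSpace ℝ (Fin 3) ≃ₗᵢ[ℝ] EuclideanSpace ℝ (Fin 3)) {y x : EuclideanSpace ℝ (Fin 3)} (hx : x ∈ X)
    (hd : dist x y = 1) (hoff : ∀ w ∈ fccSlots, x ≠ y + G w) :
    ∃ v ∈ fccSlots, ∃ n ∈ fccSlots, ⟪n, v⟫_ℝ = 1 / 2 ∧ y + G v ∉ X ∧ y + G n ∉ X ∧
      1 / 2 < ⟪x - y, G v⟫_ℝ ∧ 1 / 2 < ⟪x - y, G n⟫_ℝ := by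
  have ht : ‖x - y‖ = 1 := by rwa [← dist_eq_norm]
  have hne : ∀ w ∈ fccSlots, x - y ≠ G w := by
    intro w hw heq; exact hoff w hw (by rw [← heq]; abel)
  -- a slot whose closed cap contains `x − y`
  obtain ⟨v₀, hv₀, hcap₀⟩ := exists_slot_inner_ge_half G ht
  -- a neighbour of it strictly blocked
  obtain ⟨v, hv, -, hv'⟩ := exists_adjacent_inner_gt_half G hv₀ ht hcap₀ (hne v₀ hv₀)
  -- and a neighbour of THAT one strictly blocked
  obtain ⟨n, hn, hnv, hn'⟩ := exists_adjacent_inner_gt_half G hv ht hv'.le (hne v hv)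
  exact ⟨v, hv, n, hn, hnv, vacant_of_blocked hX G hx hd hv (hoff v hv) hv', vacant_of_blocked hX G hx hd hn (hoff n hn) hn',
    hv', hn'⟩

/-- **Hosts without an adjacent divacancy are caged.**  If at `y` no two adjacent `G`-slots are both vacant, every ball
of `X` touching `y` is a reading ball `y + G w`. -/
theorem contact_on_frame_of_no_adjacent_divacancy {X : Finset (EuclideanSpace ℝ (Fin 3))}
    (hX : ∀ p ∈ X, ∀ q ∈ X, p ≠ q → 1 ≤ dist p q)
    (G : EuclideanSpace ℝ (Fin 3) ≃ₗᵢ[ℝ] EuclideanSpace ℝ (Fin 3)) {y x : EuclideanSpace ℝ (Fin 3)} (hx : x ∈ X)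
    (hd : dist x y = 1)
    (hnodi : ∀ v ∈ fccSlots, ∀ n ∈ fccSlots, ⟪n, v⟫_ℝ = 1 / 2 → y + G v ∈ X ∨ y + G n ∈ X) :
    ∃ w ∈ fccSlots, x = y + G w := by
  by_contra hoff
  push Not at hoff
  obtain ⟨v, hv, n, hn, hnv, hvX, hnX, -, -⟩ := foreign_contact_adjacent_divacancy hX G hx hd hoff
  rcases hnodi v hv n hn hnv with h | h
  · exact hvX h
  · exact hnX h

end Summit.Ventures.Crystal3D.Theorems

end
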